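import Literature.Computability.FineGrained.SchoeningMachineStep
import HarnessLib

/-!
# Schöning's random walk for k-SAT, VI: the stack machine — walks and restarts

Topic `Literature/Computability/FineGrained`, sequel of `SchoeningMachineStep.lean` (same
register conventions). This file programs and verifies the remaining loops of `runCoins`
(`SchoeningAlgorithm.lean`):

* `initP` — **the random initial assignment** (`initAssg`): one pass over the formula; at
  each literal the assignment pass in mode `has` tells whether its variable is assigned; a
  new variable receives the next coin (`newVar`: pop `w2`, an empty register reads `false`)
  and its entry is *prepended* to `f2` (`prepend`); `runs_initP`;
* `counter K6` — the step counter `bu := 1^{K6 (|code F| + 1) + 2}` (`runs_counter`);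
* `stepLoop k` — the walk: one `stepBody` per unit of `bu` (`runs_stepLoop`, functional
  model `walkAssg` / `walkFound`);
* `walk k` — clear the old assignment, `initP`, `counter (6 · 2^k)`, `stepLoop` (`runs_walk`);
* `outer k` — **restarts**: one walk per remaining coin (`runs_outer`: the answer flag ends
  as `flag (fd || runCoins F k T c)`).

## References

* U. Schöning, FOCS 1999; F. V. Fomin, D. Kratsch, *Exact Exponential Algorithms*, Springer
  2010, Fig. 8.3 (`k-sat4`: repeat { random assignment; random walk }). [SchoeningFOCS1999]
  [FominKratsch2010]
* T. Nipkow, G. Klein, *Concrete Semantics with Isabelle/HOL*, Springer 2014, Ch. 7.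
-/

namespace Literature.Computability.FineGrained.Schoening

open Complexity Complexity.Com LightSearch _root_.Computability

/-! ### The initial assignment -/

/-- Handler of an index bit in the initial pass: re-emit on `fr`, collect on `xr`. [folklore] -/
def inBit (b : Bool) : Com R := emit .fr (.bit b) ;; .push .xr b

/-- Push the entry's index bits (popped from `xr`, last bit first) onto `f2` as `bit` tokens.
[folklore] -/
def prepLoop : Com R := .loop .xr (.push .f2 true ;; .push .f2 true) (.push .f2 false ;; .push .f2 true)

/-- Prepend the entry `(x, v)` to the assignment coded in `f2`: the code of `pol v`, then the
index bits (via `xr`). [folklore] -/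
def prepend (v : Bool) : Com R := .push .f2 v ;; .push .f2 true ;; .push .f2 false ;; pour .x .xr ;; prepLoop

/-- A new variable: its value is the next coin (an exhausted coin register reads `false`).
[folklore] -/
def newVar : Com R := .pop .w2 (prepend true) (prepend false) (prepend false)

/-- Handler of the end of a literal in the initial pass: re-emit `pol b`; the index becomes
the query; the assignment pass in mode `has` tells whether the variable is assigned; if so
drop the query, otherwise assign it. [folklore] -/
def inPol (b : Bool) : Com R := emit .fr (.pol b) ;; pour .xr .x ;; lookup .has ;; popFlag .ls (clear .x) newVar

/-- The handlers of the initial pass. [folklore] -/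
def inH : Handlers := ⟨inBit, inPol, .skip, emit .fr .endc, .skip, .skip, .skip⟩

/-- The handlers by token. [folklore] -/
theorem inH_run (t : Tok) : inH.run t =
    (match t with
      | .bit b => inBit b
      | .pol b => inPol b
      | .endc => emit .fr .endc
      | _ => .skip) := by
  cases t <;> rfl

/-- **The initial pass**: the token loop over `f`, then pour the re-emitted formula back.
[folklore] -/
def initP : Com R := tokLoop .f inH ;; pour .fr .f

/-- One step of `initGo`: the variable `y` with the assignment and coins `(al, c)`. [folklore] -/
def igStep (y : List Bool) (st : Assg × List Bool) : Assg × List Bool :=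
  if hasKey st.1 y then st else ((y, st.2.headD false) :: st.1, st.2.tail)

/-- `initGo` is the fold of `igStep`. [folklore] -/
theorem initGo_cons (y : List Bool) (ys : List (List Bool)) (al : Assg) (c : List Bool) :
    initGo (y :: ys) al c = initGo ys (igStep y (al, c)).1 (igStep y (al, c)).2 := by
  rw [initGo, igStep]; split_ifs <;> rfl

/-- The code grows by at most the entry of `y`. [folklore] -/
theorem length_igStep_le (y : List Bool) (al : Assg) (c : List Bool) :
    (bits (aToks (igStep y (al, c)).1)).length ≤ (bits (aToks al)).length + (2 * y.length + 3) := by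
  unfold igStep; split_ifs
  · simp
  · simp; omega

/-- `igStep` consumes at most one coin. [folklore] -/
theorem length_igStep_coins (y : List Bool) (al : Assg) (c : List Bool) :
    (igStep y (al, c)).2.length ≤ c.length := by
  unfold igStep; split_ifs <;> simp

/-- **`prepLoop`**: the bits on `xr` (last first) become `bit` tokens on top of `f2`;
`4 |xr| + 1` steps. [folklore] -/
theorem runs_prepLoop : ∀ (w f2 : List Bool) (ρ : RF),
    Runs prepLoop (mk { ρ with xr := w, f2 := f2 }) (mk { ρ with xr := [], f2 := bits (w.reverse.map Tok.bit) ++ f2 }) (4 * w.length + 1)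
  | [], f2, ρ => (Runs.loop_nil _ _ (by simp)).of_eq (by simp) (by simp)
  | b :: w, f2, ρ => by
    have hbody : ∀ b' : Bool, Runs (.push R.f2 b' ;; .push R.f2 true) (mk { ρ with xr := w, f2 := f2 })
        (mk { ρ with xr := w, f2 := true :: b' :: f2 }) (1 + 1) := fun b' =>
      (Runs.push' rfl).seq (Runs.push' (by simp))
    have ih := runs_prepLoop w (true :: b :: f2) ρ
    have e : bits ((b :: w).reverse.map Tok.bit) ++ f2 = bits (w.reverse.map Tok.bit) ++ (true :: b :: f2) := by
      simp [Tok.code]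
    unfold prepLoop at ih ⊢
    cases b
    · exact (Runs.loop_false' (by simp) (update_mk_xr _ w) (hbody false) ih).of_eq (by rw [e]) (by simp; omega)
    · exact (Runs.loop_true' (by simp) (update_mk_xr _ w) (hbody true) ih).of_eq (by rw [e]) (by simp; omega)

/-- **`prepend v`**: the entry `(x, v)` is prepended to the assignment coded in `f2`, the query
consumed; `7 |x| + 5` steps. [folklore] -/
theorem runs_prepend (v : Bool) (x : List Bool) (al : Assg) (ρ : RF) :
    Runs (prepend v) (mk { ρ with x := x, xr := [], f2 := bits (aToks al) })
      (mk { ρ with x := [], xr := [], f2 := bits (aToks ((x, v) :: al)) }) (7 * x.length + 5) := by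
  unfold prepend
  have a1 : Runs (.push R.f2 v) (mk { ρ with x := x, xr := [], f2 := bits (aToks al) })
      (mk { ρ with x := x, xr := [], f2 := v :: bits (aToks al) }) 1 := Runs.push' (by simp)
  have a2 : Runs (.push R.f2 true) (mk { ρ with x := x, xr := [], f2 := v :: bits (aToks al) })
      (mk { ρ with x := x, xr := [], f2 := true :: v :: bits (aToks al) }) 1 := Runs.push' (by simp)
  have a3 : Runs (.push R.f2 false) (mk { ρ with x := x, xr := [], f2 := true :: v :: bits (aToks al) })
      (mk { ρ with x := x, xr := [], f2 := false :: true :: v :: bits (aToks al) }) 1 := Runs.push' (by simp)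
  have h2 := runs_pour (a := R.x) (b := R.xr) (by decide) (mk { ρ with x := x, xr := [], f2 := false :: true :: v :: bits (aToks al) })
  have h3 := runs_prepLoop x.reverse (false :: true :: v :: bits (aToks al)) { ρ with x := [] }
  refine (a1.seq (a2.seq (a3.seq (h2.seq (h3.of_eq_init (by simp)))))).of_eq ?_ ?_
  · simp [eToks, Tok.code]
  · simp; omega

/-- **`newVar`**: the query variable is assigned the next coin and prepended; `7 |x| + 7`
steps. [folklore] -/
theorem runs_newVar (c x : List Bool) (al : Assg) (ρ : RF) :
    Runs newVar (mk { ρ with w2 := c, x := x, xr := [], f2 := bits (aToks al) })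
      (mk { ρ with w2 := c.tail, x := [], xr := [], f2 := bits (aToks ((x, c.headD false) :: al)) }) (7 * x.length + 7) := by
  unfold newVar
  cases c with
  | nil => exact (Runs.pop_nil _ _ (by simp) (runs_prepend false x al { ρ with w2 := [] })).of_eq (by simp) (by omega)
  | cons b c =>
    cases b
    · exact (Runs.pop_false' _ _ (by simp) (update_mk_w2 _ c) (runs_prepend false x al { ρ with w2 := c })).of_eq
        (by simp) (by omega)
    · exact (Runs.pop_true' _ _ (by simp) (update_mk_w2 _ c) (runs_prepend true x al { ρ with w2 := c })).of_eq
        (by simp) (by omega)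

/-- **The end of a literal in the initial pass**: the step `igStep` on (assignment, coins);
within `(23 |y| + 95) |code al| + 10 |y| + 17` steps. [folklore] -/
theorem runs_inPol (b : Bool) (ys fr c : List Bool) (al : Assg) (ρ : RF) :
    Runs (inPol b)
      (mk { ρ with
            fr := fr, xr := ys.reverse, x := [], ls := [], md := [], xc := [], mis := [], t := [], u := [], f2r := []
            f2 := bits (aToks al), w2 := c })
      (mk { ρ with
            fr := (Tok.pol b).code.reverse ++ fr, xr := [], x := [], ls := [], md := [], xc := [], mis := [], t := [], u := []
            f2r := [], f2 := bits (aToks (igStep ys (al, c)).1), w2 := (igStep ys (al, c)).2 })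
      ((23 * ys.length + 95) * (bits (aToks al)).length + 10 * ys.length + 17) := by
  unfold inPol
  set ρ₀ : RF := { ρ with
    fr := fr, xr := ys.reverse, x := [], ls := [], md := [], xc := [], mis := [], t := [], u := [], f2r := []
    f2 := bits (aToks al), w2 := c } with hρ₀
  have h1 := runs_emit R.fr (.pol b) (mk ρ₀)
  simp only [update_mk_fr, mk_fr] at h1
  have h2 := runs_pour (a := R.xr) (b := R.x) (by decide) (mk { ρ₀ with fr := (Tok.pol b).code.reverse ++ ρ₀.fr })
  set ρ₂ : RF := { ρ₀ with fr := (Tok.pol b).code.reverse ++ fr, xr := [], x := ys } with hρ₂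
  have h3 := runs_lookup .has al false ys ρ₂
  rw [luOut_of_ne_flip (by decide), luFlag_has, Bool.false_or] at h3
  set ρ₃ : RF := { ρ₂ with md := [], xc := [], mis := [], t := [], u := [], x := ys, f2r := [], ls := flag (hasKey al ys), f2 := bits (aToks al) }
    with hρ₃
  have h4 : Runs (popFlag .ls (clear .x) newVar) (mk ρ₃)
      (mk { ρ₃ with ls := [], x := [], f2 := bits (aToks (igStep ys (al, c)).1), w2 := (igStep ys (al, c)).2 }) (7 * ys.length + 7 + 2) := by
    refine runs_popFlag (b := hasKey al ys) (by simp [hρ₃]) (fun hk => ?_) (fun hk => ?_)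
    · rw [update_mk_ls]
      refine (runs_clear R.x (mk { ρ₃ with ls := [] })).of_eq ?_ ?_
      · simp [hρ₃, hρ₂, hρ₀, igStep, hk]
      · simp [hρ₃]; omega
    · have hn := runs_newVar c ys al { ρ₃ with ls := [] }
      refine (hn.of_eq_init ?_).of_eq ?_ le_rfl
      · simp [hρ₃, hρ₂, hρ₀, hk]
      · simp [hρ₃, hρ₂, hρ₀, igStep, hk]
  refine (h1.seq (h2.seq ((h3.of_eq_init ?_).seq (h4.of_eq_init ?_)))).of_eq ?_ ?_
  · simp [hρ₂, hρ₀]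
  · simp [hρ₃, hρ₂, hρ₀]
  · simp [hρ₃, hρ₂, hρ₀]
  · simp only [hρ₀, mk_xr, List.length_reverse]
    ring_nf; omega

/-- **The index bits of a literal in the initial pass** (continuation-passing form); `16` steps
per bit. [folklore] -/
theorem runs_inBits : ∀ (ys fr xr rest : List Bool) (ρ : RF) {R₂ : Regs R} {B₂ : ℕ},
    Runs (tokLoop .f inH)
      (mk { ρ with f := rest, fr := (bits (ys.map Tok.bit)).reverse ++ fr, xr := ys.reverse ++ xr }) R₂ B₂ →
    Runs (tokLoop .f inH) (mk { ρ with f := bits (ys.map Tok.bit) ++ rest, fr := fr, xr := xr }) R₂ (16 * ys.length + B₂)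
  | [], fr, xr, rest, ρ, R₂, B₂, hcont => by
    refine (hcont.of_eq_init ?_).mono (by simp)
    simp
  | b :: ys, fr, xr, rest, ρ, R₂, B₂, hcont => by
    have h1 : Runs (inBit b) (mk { ρ with f := bits (ys.map Tok.bit) ++ rest, fr := fr, xr := xr })
        (mk { ρ with f := bits (ys.map Tok.bit) ++ rest, fr := (Tok.bit b).code.reverse ++ fr, xr := b :: xr }) 6 := by
      unfold inBit
      have a := runs_emit R.fr (.bit b) (mk { ρ with f := bits (ys.map Tok.bit) ++ rest, fr := fr, xr := xr })
      simp only [update_mk_fr, mk_fr] at a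
      exact (a.seq (Runs.push' rfl)).of_eq (by simp) (by omega)
    have h2 := runs_inBits ys ((Tok.bit b).code.reverse ++ fr) (b :: xr) rest ρ (R₂ := R₂) (B₂ := B₂)
      (hcont.of_eq_init (by simp [List.reverse_append]))
    have h := runs_tokLoop_cons (k := R.f) (H := inH) (t := .bit b) (rest := bits (ys.map Tok.bit) ++ rest)
      (Rg := mk { ρ with f := bits ((b :: ys).map Tok.bit) ++ rest, fr := fr, xr := xr })
      (by simp) (by rw [inH_run]; exact h1.of_eq_init (by simp)) h2
    exact h.of_eq rfl (by simp; omega)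

/-- **One literal in the initial pass** (continuation-passing form): the state (assignment,
coins) becomes `igStep`; within `95 (|code al| + 1) (|y| + 1)` steps. [folklore] -/
theorem runs_inLit (l : Literal (List Bool)) (fr rest c : List Bool) (al : Assg) (ρ : RF) {R₂ : Regs R} {B₂ : ℕ}
    (hcont : Runs (tokLoop .f inH)
      (mk { ρ with
            f := rest, fr := (bits (eToks l)).reverse ++ fr, xr := [], x := [], ls := [], md := [], xc := [], mis := []
            t := [], u := [], f2r := [], f2 := bits (aToks (igStep l.1 (al, c)).1), w2 := (igStep l.1 (al, c)).2 }) R₂ B₂) :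
    Runs (tokLoop .f inH)
      (mk { ρ with
            f := bits (eToks l) ++ rest, fr := fr, xr := [], x := [], ls := [], md := [], xc := [], mis := []
            t := [], u := [], f2r := [], f2 := bits (aToks al), w2 := c }) R₂
      (95 * ((bits (aToks al)).length + 1) * (l.1.length + 1) + B₂) := by
  obtain ⟨ys, b⟩ := l
  simp only [eToks, bits_append, bits_cons, bits_nil, List.append_nil, List.reverse_append,
    List.append_assoc] at hcont ⊢
  set ρb : RF := { ρ with x := [], ls := [], md := [], xc := [], mis := [], t := [], u := [], f2r := [], f2 := bits (aToks al), w2 := c }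
    with hρb
  have hpol : Runs (tokLoop .f inH)
      (mk { ρb with f := (Tok.pol b).code ++ rest, fr := (bits (ys.map Tok.bit)).reverse ++ fr, xr := ys.reverse ++ [] })
      R₂ ((23 * ys.length + 95) * (bits (aToks al)).length + 10 * ys.length + 17 + 10 + B₂) := by
    have h1 := runs_inPol b ys ((bits (ys.map Tok.bit)).reverse ++ fr) c al { ρ with f := rest }
    refine runs_tokLoop_cons (t := .pol b) (rest := rest) (by simp [hρb]) (by
      rw [inH_run]; exact h1.of_eq_init (by simp [hρb])) (hcont.of_eq_init ?_)
    simp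
  have h := runs_inBits ys fr [] ((Tok.pol b).code ++ rest) ρb hpol
  refine (h.of_eq_init (by simp [hρb])).mono ?_
  nlinarith [Nat.zero_le ys.length, Nat.zero_le (bits (aToks al)).length]

/-- **The literals of a clause in the initial pass** (continuation-passing form): the state
becomes `initGo` over their variables; if the code of the assignment plus the code still to
be read is at most `N`, within `95 (N + 1) |code lits|` steps. [folklore] -/
theorem runs_inLits : ∀ (C : Clause (List Bool)) (fr rest c : List Bool) (al : Assg) (N : ℕ) (ρ : RF)
    {R₂ : Regs R} {B₂ : ℕ},
    (bits (aToks al)).length + (bits (aToks C)).length ≤ N →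
    Runs (tokLoop .f inH)
      (mk { ρ with
            f := rest, fr := (bits (aToks C)).reverse ++ fr, xr := [], x := [], ls := [], md := [], xc := [], mis := []
            t := [], u := [], f2r := [], f2 := bits (aToks (initGo (C.map Prod.fst) al c).1)
            w2 := (initGo (C.map Prod.fst) al c).2 }) R₂ B₂ →
    Runs (tokLoop .f inH)
      (mk { ρ with
            f := bits (aToks C) ++ rest, fr := fr, xr := [], x := [], ls := [], md := [], xc := [], mis := []
            t := [], u := [], f2r := [], f2 := bits (aToks al), w2 := c }) R₂ (95 * (N + 1) * (bits (aToks C)).length + B₂)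
  | [], fr, rest, c, al, N, ρ, R₂, B₂, _, hcont => by
    refine (hcont.of_eq_init ?_).mono (by simp)
    simp [initGo]
  | l :: C, fr, rest, c, al, N, ρ, R₂, B₂, hN, hcont => by
    rw [aToks_cons, bits_append, List.length_append, length_bits_eToks] at hN
    have hN' : (bits (aToks (igStep l.1 (al, c)).1)).length + (bits (aToks C)).length ≤ N :=
      le_trans (Nat.add_le_add_right (length_igStep_le l.1 al c) _) (by omega)
    have h2 := runs_inLits C ((bits (eToks l)).reverse ++ fr) rest (igStep l.1 (al, c)).2 (igStep l.1 (al, c)).1 N ρ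
      (R₂ := R₂) (B₂ := B₂) hN' (hcont.of_eq_init (by simp [List.reverse_append, initGo_cons]))
    have h1 := runs_inLit l fr (bits (aToks C) ++ rest) c al ρ h2
    refine (h1.of_eq_init (by simp)).mono ?_
    simp only [aToks_cons, bits_append, List.length_append, length_bits_eToks]
    have hla : (bits (aToks al)).length ≤ N := by omega
    nlinarith [hla, Nat.zero_le l.1.length, Nat.zero_le (bits (aToks C)).length]

/-- **The clause list in the initial pass** (continuation-passing form): the state becomes
`initGo` over `occs F`; within `99 (N + 1) |code F|` steps if the code of the assignment plus
the code still to be read is at most `N`. [folklore] -/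
theorem runs_inFormula : ∀ (F : CNF (List Bool)) (fr rest c : List Bool) (al : Assg) (N : ℕ) (ρ : RF)
    {R₂ : Regs R} {B₂ : ℕ},
    (bits (aToks al)).length + (bits (fToks F)).length ≤ N →
    Runs (tokLoop .f inH)
      (mk { ρ with
            f := rest, fr := (bits (fToks F)).reverse ++ fr, xr := [], x := [], ls := [], md := [], xc := [], mis := []
            t := [], u := [], f2r := [], f2 := bits (aToks (initGo (occs F) al c).1), w2 := (initGo (occs F) al c).2 }) R₂ B₂ →
    Runs (tokLoop .f inH)
      (mk { ρ with
            f := bits (fToks F) ++ rest, fr := fr, xr := [], x := [], ls := [], md := [], xc := [], mis := []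
            t := [], u := [], f2r := [], f2 := bits (aToks al), w2 := c }) R₂ (99 * (N + 1) * (bits (fToks F)).length + B₂)
  | [], fr, rest, c, al, N, ρ, R₂, B₂, _, hcont => by
    refine (hcont.of_eq_init ?_).mono (by simp)
    simp [occs, initGo]
  | C :: F, fr, rest, c, al, N, ρ, R₂, B₂, hN, hcont => by
    rw [fToks_cons, bits_append, List.length_append] at hN
    have hC4 : (bits (cToks C)).length = (bits (aToks C)).length + 4 := by simp [cToks, Tok.code]
    -- `occs (C :: F) = C.map fst ++ occs F`, and `initGo` splits accordingly
    have hoccs : occs (C :: F) = C.map Prod.fst ++ occs F := by simp [occs]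
    have hsplit : ∀ (xs ys : List (List Bool)) (al' : Assg) (c' : List Bool),
        initGo (xs ++ ys) al' c' = initGo ys (initGo xs al' c').1 (initGo xs al' c').2 := by
      intro xs; induction xs with
      | nil => intro ys al' c'; rfl
      | cons x xs ih => intro ys al' c'; rw [List.cons_append, initGo_cons, initGo_cons, ih]
    set st₁ := initGo (C.map Prod.fst) al c with hst₁
    have hgrow : ∀ (xs : Clause (List Bool)) (al' : Assg) (c' : List Bool),
        (bits (aToks (initGo (xs.map Prod.fst) al' c').1)).length ≤ (bits (aToks al')).length + (bits (aToks xs)).length := by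
      intro xs; induction xs with
      | nil => intro al' c'; simp [initGo]
      | cons l xs ih =>
        intro al' c'
        rw [List.map_cons, initGo_cons, aToks_cons, bits_append, List.length_append, length_bits_eToks]
        exact (ih _ _).trans (by have := length_igStep_le l.1 al' c'; omega)
    have hN' : (bits (aToks st₁.1)).length + (bits (fToks F)).length ≤ N := by
      have := hgrow C al c; rw [← hst₁] at this; omega
    -- the clauses of `F` after this one
    have h3 := runs_inFormula F ((bits (cToks C)).reverse ++ fr) rest st₁.2 st₁.1 N ρ (R₂ := R₂) (B₂ := B₂) hN'
      (hcont.of_eq_init (by simp [List.reverse_append, hoccs, hsplit, hst₁]))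
    -- the closing `endc` of this clause
    have hend : Runs (tokLoop .f inH)
        (mk { ρ with
              f := Tok.endc.code ++ (bits (fToks F) ++ rest), fr := (bits (aToks C)).reverse ++ fr, xr := [], x := [], ls := []
              md := [], xc := [], mis := [], t := [], u := [], f2r := [], f2 := bits (aToks st₁.1), w2 := st₁.2 }) R₂
        (5 + 10 + (99 * (N + 1) * (bits (fToks F)).length + B₂)) := by
      have he := runs_emit R.fr .endc (mk { ρ with
        f := bits (fToks F) ++ rest, fr := (bits (aToks C)).reverse ++ fr, xr := [], x := [], ls := []
        md := [], xc := [], mis := [], t := [], u := [], f2r := [], f2 := bits (aToks st₁.1), w2 := st₁.2 })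
      simp only [update_mk_fr, mk_fr] at he
      refine runs_tokLoop_cons (t := .endc) (rest := bits (fToks F) ++ rest) (by simp) (by
        rw [inH_run]; exact he.of_eq_init (by simp)) (h3.of_eq_init ?_)
      simp [cToks, List.reverse_append]
    have h1 := runs_inLits C fr (Tok.endc.code ++ (bits (fToks F) ++ rest)) c al N ρ (by rw [hC4] at hN; omega)
      (hend.of_eq_init (by simp [hst₁]))
    refine (h1.of_eq_init (by simp [cToks])).mono ?_
    rw [fToks_cons, bits_append, List.length_append, hC4]
    nlinarith [Nat.zero_le (bits (aToks C)).length, Nat.zero_le (bits (fToks F)).length, Nat.zero_le N]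

/-- **The initial pass** from an empty assignment: `f2` receives the code of `(initAssg F c).1`,
`w2` keeps `(initAssg F c).2`, `f` is restored; within `99 (|code F| + 1) |code F| + 3 |code F| + 2`
steps. [folklore] -/
theorem runs_initP (F : CNF (List Bool)) (c : List Bool) (ρ : RF) :
    Runs initP
      (mk { ρ with
            f := bits (fToks F), fr := [], xr := [], x := [], ls := [], md := [], xc := [], mis := []
            t := [], u := [], f2r := [], f2 := [], w2 := c })
      (mk { ρ with
            f := bits (fToks F), fr := [], xr := [], x := [], ls := [], md := [], xc := [], mis := []
            t := [], u := [], f2r := [], f2 := bits (aToks (initAssg F c).1), w2 := (initAssg F c).2 })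
      (99 * ((bits (fToks F)).length + 1) * (bits (fToks F)).length + 3 * (bits (fToks F)).length + 2) := by
  unfold initP
  set ρ₁ : RF := { ρ with
    f := [], fr := (bits (fToks F)).reverse ++ [], xr := [], x := [], ls := [], md := [], xc := [], mis := []
    t := [], u := [], f2r := [], f2 := bits (aToks (initGo (occs F) [] c).1), w2 := (initGo (occs F) [] c).2 } with hρ₁
  have h1 := runs_inFormula F [] [] c [] (bits (fToks F)).length ρ (R₂ := mk ρ₁) (B₂ := 1) (by simp)
    (runs_tokLoop_nil (by simp))
  have h2 := runs_pour (a := R.fr) (b := R.f) (by decide) (mk ρ₁)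
  refine ((h1.of_eq_init (by simp)).seq h2).of_eq ?_ ?_
  · simp [hρ₁, initAssg]
  · simp [hρ₁]; omega

/-! ### The step counter -/

/-- The counting loop: per bit of `f` (moved to `fr`) push `K6` units on `bu`. [folklore] -/
def cntLoop (K6 : ℕ) : Com R := .loop .f (.push .fr true ;; pushN .bu true K6) (.push .fr false ;; pushN .bu true K6)

/-- **The step counter**: `bu := 1^{K6 (|f| + 1) + 2}`, `f` restored. [folklore] -/
def counter (K6 : ℕ) : Com R := cntLoop K6 ;; pour .fr .f ;; pushN .bu true (K6 + 2)

/-- `cntLoop` on `f = w`: `(K6 + 3) |w| + 1` steps. [folklore] -/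
theorem runs_cntLoop (K6 : ℕ) : ∀ (w fr bu : List Bool) (ρ : RF),
    Runs (cntLoop K6) (mk { ρ with f := w, fr := fr, bu := bu })
      (mk { ρ with f := [], fr := w.reverse ++ fr, bu := List.replicate (K6 * w.length) true ++ bu }) ((K6 + 3) * w.length + 1)
  | [], fr, bu, ρ => (Runs.loop_nil _ _ (by simp)).of_eq (by simp) (by simp)
  | b :: w, fr, bu, ρ => by
    have hbody : ∀ b' : Bool, Runs (.push R.fr b' ;; pushN .bu true K6) (mk { ρ with f := w, fr := fr, bu := bu })
        (mk { ρ with f := w, fr := b' :: fr, bu := List.replicate K6 true ++ bu }) (1 + K6) := fun b' =>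
      (Runs.push' rfl).seq ((runs_pushN R.bu true K6 _).of_eq (by simp) le_rfl)
    have ih := fun b' : Bool => runs_cntLoop K6 w (b' :: fr) (List.replicate K6 true ++ bu) ρ
    have e : ∀ b' : Bool, mk { ρ with f := [], fr := w.reverse ++ b' :: fr, bu := List.replicate (K6 * w.length) true ++ (List.replicate K6 true ++ bu) } =
        mk { ρ with f := [], fr := (b' :: w).reverse ++ fr, bu := List.replicate (K6 * (b' :: w).length) true ++ bu } := by
      intro b'
      rw [List.length_cons, Nat.mul_succ, List.replicate_add, List.append_assoc, List.reverse_cons, List.append_assoc]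
      rfl
    unfold cntLoop at ih ⊢
    cases b
    · exact (Runs.loop_false' (by simp) (update_mk_f _ w) (hbody false) (ih false)).of_eq (e false) (by simp; ring_nf; omega)
    · exact (Runs.loop_true' (by simp) (update_mk_f _ w) (hbody true) (ih true)).of_eq (e true) (by simp; ring_nf; omega)

/-- **The step counter** on `f = w` with `fr`, `bu` empty: `bu = 1^{K6 (|w| + 1) + 2}`;
`(K6 + 6) |w| + K6 + 4` steps. [folklore] -/
theorem runs_counter (K6 : ℕ) (w : List Bool) (ρ : RF) :
    Runs (counter K6) (mk { ρ with f := w, fr := [], bu := [] })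
      (mk { ρ with f := w, fr := [], bu := List.replicate (K6 * (w.length + 1) + 2) true }) ((K6 + 6) * w.length + K6 + 4) := by
  unfold counter
  have h1 := runs_cntLoop K6 w [] [] ρ
  have h2 := runs_pour (a := R.fr) (b := R.f) (by decide) (mk { ρ with f := [], fr := w.reverse ++ [], bu := List.replicate (K6 * w.length) true ++ [] })
  have h3 := runs_pushN R.bu true (K6 + 2)
    (mk { ρ with f := w, fr := [], bu := List.replicate (K6 * w.length) true })
  refine (h1.seq ((h2.of_eq (by simp) le_rfl).seq h3)).of_eq ?_ ?_
  · simp only [update_mk_bu, mk_bu, ← List.replicate_add]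
    congr 2; ring
  · simp; ring_nf; omega

/-! ### The walk -/

/-- The loop of steps: one `stepBody` per unit of `bu`. [folklore] -/
def stepLoop (k : ℕ) : Com R := .loop .bu (stepBody k) (stepBody k)

/-- The assignment after `n` lazy steps from `al` on the coins `c`. [folklore] -/
def walkAssg (F : CNF (List Bool)) (k : ℕ) : ℕ → Assg → List Bool → Assg
  | 0, al, _ => al
  | n + 1, al, c => walkAssg F k n (stepAssg F al (takePad k c)) (c.drop k)

/-- A step does not change the code length of the assignment. [folklore] -/
theorem length_bits_aToks_stepAssg (F : CNF (List Bool)) (al : Assg) (ω : List Bool) :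
    (bits (aToks (stepAssg F al ω))).length = (bits (aToks al)).length := by
  rcases stepAssg_eq_or F al ω with h | ⟨C, -, l, -, h⟩
  · rw [h]
  · rw [h, ← luOut_flip, length_bits_aToks_luOut]

/-- Nor does a walk. [folklore] -/
theorem length_bits_aToks_walkAssg (F : CNF (List Bool)) (k : ℕ) : ∀ (n : ℕ) (al : Assg) (c : List Bool),
    (bits (aToks (walkAssg F k n al c))).length = (bits (aToks al)).length
  | 0, al, c => rfl
  | n + 1, al, c => by rw [walkAssg, length_bits_aToks_walkAssg F k n, length_bits_aToks_stepAssg]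

/-- **The loop of steps follows `walkFound`**: `n` steps from `al` on the coins `c` with the
answer flag at `fd` leave `walkAssg F k n al c` in `f2`, `c.drop (k n)` in `w2` and
`flag (fd || walkFound F k n al c)` in `o`; within `n (stepCost + 2) + 1` steps. [folklore] -/
theorem runs_stepLoop (k : ℕ) (F : CNF (List Bool))
    (hidx : ∀ C ∈ F, ∀ l ∈ C, l.1.length ≤ (bits (fToks F)).length)
    (hlen : ∀ C ∈ F, (bits (cToks C)).length ≤ (bits (fToks F)).length) :
    ∀ (n : ℕ) (al : Assg) (c : List Bool) (fd : Bool) (ρ : RF),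
    Runs (stepLoop k)
      (mk { ρ with
            bu := List.replicate n true, w2 := c, f := bits (fToks F), f2 := bits (aToks al), o := flag fd
            fr := [], lb := [], xr := [], x := [], ls := [], sat := [], he := [], cb := [], hd := [], cc := [], uu := []
            md := [], xc := [], mis := [], t := [], u := [], f2r := [] })
      (mk { ρ with
            bu := [], w2 := c.drop (k * n), f := bits (fToks F), f2 := bits (aToks (walkAssg F k n al c))
            o := flag (fd || walkFound F k n al c)
            fr := [], lb := [], xr := [], x := [], ls := [], sat := [], he := [], cb := [], hd := [], cc := [], uu := []
            md := [], xc := [], mis := [], t := [], u := [], f2r := [] })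
      (n * (stepCost k (bits (fToks F)).length (bits (aToks al)).length + 2) + 1)
  | 0, al, c, fd, ρ => (Runs.loop_nil _ _ (by simp)).of_eq (by simp [walkAssg, walkFound]) (by simp)
  | n + 1, al, c, fd, ρ => by
    have h1 := runs_stepBody k F al c fd { ρ with bu := List.replicate n true } hidx hlen
    have h2 := runs_stepLoop k F hidx hlen n (stepAssg F al (takePad k c)) (c.drop k) (fd || good F al) ρ
    rw [length_bits_aToks_stepAssg] at h2
    unfold stepLoop at h2 ⊢
    refine (Runs.loop_true' (by simp [List.replicate_succ]) (update_mk_bu _ (List.replicate n true)) (h1.of_eq_init (by simp))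
      (h2.of_eq_init (by simp))).of_eq ?_ ?_
    · simp [walkAssg, walkFound, List.drop_drop, Nat.mul_succ, Bool.or_assoc, Nat.add_comm]
    · ring_nf; omega

/-- **One walk**: drop the previous assignment, draw the random initial assignment, set the
counter, walk. (Fomin–Kratsch 2010, Fig. 8.3, the body of the repeat loop.)
[cite: FominKratsch2010, Fig. 8.3 (k-sat4)] -/
def walk (k : ℕ) : Com R := clear .f2 ;; initP ;; counter (6 * 2 ^ k) ;; stepLoop k

/-- The number of steps of a walk on a formula of code length `Lf`. [folklore] -/
def stepsOf (k Lf : ℕ) : ℕ := 6 * 2 ^ k * (Lf + 1) + 2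

/-- The cost of one walk on a formula of code length `Lf`, from an assignment register of
length `≤ Lf` (the previous walk's). [folklore] -/
def walkCost (k Lf : ℕ) : ℕ :=
  (2 * Lf + 1) + (99 * (Lf + 1) * Lf + 3 * Lf + 2) + ((6 * 2 ^ k + 6) * Lf + 6 * 2 ^ k + 4) +
    (stepsOf k Lf * (stepCost k Lf Lf + 2) + 1)

/-- The entry codes of all literal occurrences fit in the formula code. [folklore] -/
theorem sum_occs_le (F : CNF (List Bool)) :
    ((occs F).map fun y => 2 * y.length + 3).sum ≤ (bits (fToks F)).length := by
  induction F with
  | nil => simp [occs]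
  | cons C F ih =>
    have hC : ((C.map Prod.fst).map fun y => 2 * y.length + 3).sum = (bits (aToks C)).length := by
      rw [length_bits_aToks, List.map_map]; rfl
    have hocc : occs (C :: F) = C.map Prod.fst ++ occs F := by simp [occs]
    rw [hocc, List.map_append, List.sum_append, hC, fToks_cons, bits_append, List.length_append]
    have : (bits (cToks C)).length = (bits (aToks C)).length + 4 := by simp [cToks, Tok.code]
    omega

/-- The code of the initial assignment is not longer than the code of the formula (its entries
are the entries of distinct literal occurrences). [folklore] -/
theorem length_bits_aToks_initAssg_le (F : CNF (List Bool)) (c : List Bool) :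
    (bits (aToks (initAssg F c).1)).length ≤ (bits (fToks F)).length := by
  -- `initGo` over any list of variables adds at most their entry codes
  have key : ∀ (xs : List (List Bool)) (al : Assg) (c : List Bool),
      (bits (aToks (initGo xs al c).1)).length ≤ (bits (aToks al)).length + (xs.map fun y => 2 * y.length + 3).sum := by
    intro xs; induction xs with
    | nil => intro al c; simp [initGo]
    | cons y xs ih =>
      intro al c
      rw [initGo_cons, List.map_cons, List.sum_cons]
      exact (ih _ _).trans (by have := length_igStep_le y al c; omega)
  have h := key (occs F) [] c
  simp only [aToks_nil, bits_nil, List.length_nil, zero_add] at h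
  exact h.trans (sum_occs_le F)

/-- **One walk follows the specification**: with `(al₀, c₀) := initAssg F c` and
`T := stepsOf k |code F|`, the walk leaves `walkAssg F k T al₀ c₀` in `f2`, `c₀.drop (k T)` in
`w2` and `flag (fd || walkFound F k T al₀ c₀)` in `o`; within `walkCost k |code F|` steps,
provided the old assignment register was no longer than the formula code. [folklore] -/
theorem runs_walk (k : ℕ) (F : CNF (List Bool)) (alOld : List Bool) (hold : alOld.length ≤ (bits (fToks F)).length)
    (c : List Bool) (fd : Bool) (ρ : RF)
    (hidx : ∀ C ∈ F, ∀ l ∈ C, l.1.length ≤ (bits (fToks F)).length)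
    (hlen : ∀ C ∈ F, (bits (cToks C)).length ≤ (bits (fToks F)).length) :
    Runs (walk k)
      (mk { ρ with
            bu := [], w2 := c, f := bits (fToks F), f2 := alOld, o := flag fd
            fr := [], lb := [], xr := [], x := [], ls := [], sat := [], he := [], cb := [], hd := [], cc := [], uu := []
            md := [], xc := [], mis := [], t := [], u := [], f2r := [] })
      (mk { ρ with
            bu := [], w2 := (initAssg F c).2.drop (k * stepsOf k (bits (fToks F)).length), f := bits (fToks F)
            f2 := bits (aToks (walkAssg F k (stepsOf k (bits (fToks F)).length) (initAssg F c).1 (initAssg F c).2))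
            o := flag (fd || walkFound F k (stepsOf k (bits (fToks F)).length) (initAssg F c).1 (initAssg F c).2)
            fr := [], lb := [], xr := [], x := [], ls := [], sat := [], he := [], cb := [], hd := [], cc := [], uu := []
            md := [], xc := [], mis := [], t := [], u := [], f2r := [] })
      (walkCost k (bits (fToks F)).length) := by
  unfold walk
  set Lf := (bits (fToks F)).length with hLf
  set ρ₀ : RF := { ρ with
    bu := [], w2 := c, f := bits (fToks F), f2 := alOld, o := flag fd
    fr := [], lb := [], xr := [], x := [], ls := [], sat := [], he := [], cb := [], hd := [], cc := [], uu := []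
    md := [], xc := [], mis := [], t := [], u := [], f2r := [] } with hρ₀
  have h1 := runs_clear R.f2 (mk ρ₀)
  simp only [update_mk_f2, mk_f2] at h1
  have h2 := runs_initP F c { ρ₀ with f2 := [] }
  set st := initAssg F c with hst
  have h3 := runs_counter (6 * 2 ^ k) (bits (fToks F)) { ρ₀ with f2 := bits (aToks st.1), w2 := st.2 }
  have h4 := runs_stepLoop k F hidx hlen (stepsOf k Lf) st.1 st.2 fd
    { ρ₀ with f2 := bits (aToks st.1), w2 := st.2 }
  have hla : (bits (aToks st.1)).length ≤ Lf := by rw [hst, hLf]; exact length_bits_aToks_initAssg_le F c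
  refine (h1.seq ((h2.of_eq_init (by simp [hρ₀])).seq ((h3.of_eq_init (by simp [hρ₀])).seq
    ((h4.of_eq_init (by simp [hρ₀, stepsOf, hLf])).of_eq rfl le_rfl)))).of_eq ?_ ?_
  · simp [hρ₀, hst]
  · -- the cost: `stepCost` is monotone in the assignment length
    have hmono : stepCost k Lf (bits (aToks st.1)).length ≤ stepCost k Lf Lf := by
      unfold stepCost; nlinarith [hla, Nat.zero_le Lf]
    have hsteps : stepsOf k Lf * (stepCost k Lf (bits (aToks st.1)).length + 2) ≤ stepsOf k Lf * (stepCost k Lf Lf + 2) :=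
      Nat.mul_le_mul_left _ (by omega)
    simp only [hρ₀, walkCost, ← hLf]
    omega

/-! ### Restarts -/

/-- **The restart loop**: one walk per remaining coin. (Fomin–Kratsch 2010, Fig. 8.3, the
repeat loop; here driven by the coin supply.) [cite: FominKratsch2010, Fig. 8.3 (k-sat4)] -/
def outer (k : ℕ) : Com R := .loop .w2 (walk k) (walk k)

/-- **The restart loop follows `runCoins`**: from coins `c`, answer flag `fd` and an
assignment register no longer than the formula code, the loop ends with `w2` empty, the
answer flag `flag (fd || runCoins F k T c)` (`T = stepsOf k |code F|`) and some assignment of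
code length `≤ |code F|` in `f2`; within `|c| (walkCost + 2) + 1` steps. [folklore] -/
theorem runs_outer (k : ℕ) (F : CNF (List Bool))
    (hidx : ∀ C ∈ F, ∀ l ∈ C, l.1.length ≤ (bits (fToks F)).length)
    (hlen : ∀ C ∈ F, (bits (cToks C)).length ≤ (bits (fToks F)).length) :
    ∀ (n : ℕ) (c : List Bool) (_ : c.length ≤ n) (alOld : List Bool) (_ : alOld.length ≤ (bits (fToks F)).length)
      (fd : Bool) (ρ : RF),
    ∃ alNew : List Bool, alNew.length ≤ (bits (fToks F)).length ∧
    Runs (outer k)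
      (mk { ρ with
            bu := [], w2 := c, f := bits (fToks F), f2 := alOld, o := flag fd
            fr := [], lb := [], xr := [], x := [], ls := [], sat := [], he := [], cb := [], hd := [], cc := [], uu := []
            md := [], xc := [], mis := [], t := [], u := [], f2r := [] })
      (mk { ρ with
            bu := [], w2 := [], f := bits (fToks F), f2 := alNew
            o := flag (fd || runCoins F k (stepsOf k (bits (fToks F)).length) c)
            fr := [], lb := [], xr := [], x := [], ls := [], sat := [], he := [], cb := [], hd := [], cc := [], uu := []
            md := [], xc := [], mis := [], t := [], u := [], f2r := [] })
      (c.length * (walkCost k (bits (fToks F)).length + 2) + 1)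
  | _, [], _, alOld, hold, fd, ρ => ⟨alOld, hold, (Runs.loop_nil _ _ (by simp)).of_eq (by simp) (by simp)⟩
  | 0, b :: c, hn, _, _, _, _ => by simp at hn
  | n + 1, b :: c, hn, alOld, hold, fd, ρ => by
    set T := stepsOf k (bits (fToks F)).length with hT
    set st := initAssg F c with hst
    -- one walk on `c`, then the loop on the remaining coins
    have h1 := runs_walk k F alOld hold c fd ρ hidx hlen
    have hle : (st.2.drop (k * T)).length ≤ c.length := by
      have := length_initGo_le (occs F) [] c
      simp only [hst, initAssg, List.length_drop] at this ⊢
      omega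
    obtain ⟨alNew, hnew, h2⟩ := runs_outer k F hidx hlen n (st.2.drop (k * T)) (by simp at hn; omega)
      (bits (aToks (walkAssg F k T st.1 st.2)))
      (by rw [length_bits_aToks_walkAssg, hst]; exact length_bits_aToks_initAssg_le F c)
      (fd || walkFound F k T st.1 st.2) ρ
    refine ⟨alNew, hnew, ?_⟩
    unfold outer at h2 ⊢
    have e : mk { ρ with
        bu := [], w2 := [], f := bits (fToks F), f2 := alNew
        o := flag (fd || walkFound F k T st.1 st.2 || runCoins F k T (st.2.drop (k * T)))
        fr := [], lb := [], xr := [], x := [], ls := [], sat := [], he := [], cb := [], hd := [], cc := [], uu := []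
        md := [], xc := [], mis := [], t := [], u := [], f2r := [] } =
      mk { ρ with
        bu := [], w2 := [], f := bits (fToks F), f2 := alNew
        o := flag (fd || runCoins F k T (b :: c))
        fr := [], lb := [], xr := [], x := [], ls := [], sat := [], he := [], cb := [], hd := [], cc := [], uu := []
        md := [], xc := [], mis := [], t := [], u := [], f2r := [] } := by
      rw [runCoins_cons, ← hst, Bool.or_assoc]
    have hfin : Runs (Com.loop R.w2 (walk k) (walk k)) (mk { ρ with
        bu := [], w2 := b :: c, f := bits (fToks F), f2 := alOld, o := flag fd
        fr := [], lb := [], xr := [], x := [], ls := [], sat := [], he := [], cb := [], hd := [], cc := [], uu := []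
        md := [], xc := [], mis := [], t := [], u := [], f2r := [] })
      (mk { ρ with
        bu := [], w2 := [], f := bits (fToks F), f2 := alNew
        o := flag (fd || runCoins F k T (b :: c))
        fr := [], lb := [], xr := [], x := [], ls := [], sat := [], he := [], cb := [], hd := [], cc := [], uu := []
        md := [], xc := [], mis := [], t := [], u := [], f2r := [] })
      (walkCost k (bits (fToks F)).length + 2 + ((st.2.drop (k * T)).length * (walkCost k (bits (fToks F)).length + 2) + 1)) := by
      cases b
      · exact (Runs.loop_false' (by simp) (update_mk_w2 _ c) (h1.of_eq (by simp [hst, hT]) le_rfl) h2).of_eq e le_rfl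
      · exact (Runs.loop_true' (by simp) (update_mk_w2 _ c) (h1.of_eq (by simp [hst, hT]) le_rfl) h2).of_eq e le_rfl
    refine hfin.mono ?_
    have := Nat.mul_le_mul_right (walkCost k (bits (fToks F)).length + 2) hle
    simp only [List.length_cons]
    nlinarith [this]

end Literature.Computability.FineGrained.Schoening
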